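import Summits.AtomisticToContinuum.HydrodynamicLimit.Theorems.LambertianContactSwapSwapGapStubFieldConcentrationStatic
import Summits.AtomisticToContinuum.HydrodynamicLimit.Theorems.LambertianContactSwapSwapGapEntropyTools
import Summits.AtomisticToContinuum.HydrodynamicLimit.Theorems.LambertianContactSwapSwapGapEntropyTransfer
import HarnessLib

/-!
# `SwapGap` (stmt-AtomisticToContinuum-11850), line `Sketch`, stub `stub_detFieldConcentration_equilibrium` (T22):
# deterministic field concentration S2ʳ on the EQUILIBRIUM rung, all real times

Rung T22 of v12 §12 (the reversed entropy line) of line `Sketch` for the crux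
`Summit.AtomisticToContinuum.HydrodynamicLimit.Theses.LambertianContactSwap.SwapGap`.
The research stub S2ʳ (`stub_detFieldConcentration`) asks for speed-`N` concentration of bounded
`1`-Lipschitz statistics `F` of the `χ`-tested empirical field triple `(density, momentum, energy)` of
the DETERMINISTICALLY evolved configuration `Φ_t z` under the local Gibbs law, about its own mean.
Here: for CONSTANT profiles `a₀ ≡ a > 0`, `θ₀ ≡ θ > 0`, `u₀ ≡ u` it holds for ALL real `t`, uniformly
in `N` and in the flow `Φ`.

Mechanism: the homogeneous Gibbs law `G_N = localGibbsLaw σ a u θ N Φ` is invariant under every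
hard-sphere flow (`map_flow_localGibbsLaw_const`: `(Φ_t)_# G_N = G_N`), so the mean
`∫ F(fld(Φ_t w)) dG_N = ∫ F(fld) d((Φ_t)_# G_N) = ∫ F(fld) dG_N` (`integral_map`) and the event
`{δ < |F(fld(Φ_t z)) − mean|} = Φ_t⁻¹' {δ < |F(fld) − mean|}` has `G_N`-measure equal to the static
one (`Measure.map_apply`); the static bound is rung R0 (`stub_fieldConcentration_static`) applied to
the constant profiles.

prover-line-stmt-AtomisticToContinuum-11850-c6-0, cycle 7 (stub worker T22).
-/

noncomputable section

open MeasureTheory Filter Set Topology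
open scoped ENNReal

namespace Summit.AtomisticToContinuum.HydrodynamicLimit.Theorems

open Literature.Analysis.FluidPDE Literature.MathematicalPhysics.KineticTheory
open Summit.AtomisticToContinuum.HydrodynamicLimit.Theses.LambertianContactSwap

/-- **Invariant measures do not see the dynamics in deviation events.** If `μ.map T = μ` for a
measurable self-map `T` and `g` is a real measurable statistic, then the `μ`-measure of the deviation
event `{δ < |g ∘ T − ∫ g ∘ T dμ|}` equals that of the static event `{δ < |g − ∫ g dμ|}`: the mean is
unchanged (`integral_map`) and the event is the `T`-preimage of the static one (`Measure.map_apply`).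
[folklore] -/
private theorem measure_setOf_lt_abs_comp_sub_integral_eq_of_map_eq {α : Type*} [MeasurableSpace α]
    {μ : Measure α} {T : α → α} (hT : Measurable T) (hinv : μ.map T = μ) {g : α → ℝ}
    (hg : Measurable g) (δ : ℝ) :
    μ {z | δ < |g (T z) - ∫ w, g (T w) ∂μ|} = μ {z | δ < |g z - ∫ w, g w ∂μ|} := by
  have hmean : ∫ w, g (T w) ∂μ = ∫ w, g w ∂μ := by
    rw [← integral_map hT.aemeasurable hg.aestronglyMeasurable, hinv]
  have hA : MeasurableSet {y | δ < |g y - ∫ w, g w ∂μ|} :=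
    measurableSet_lt measurable_const (hg.sub measurable_const).abs
  have hpre : {z | δ < |g (T z) - ∫ w, g w ∂μ|} = T ⁻¹' {y | δ < |g y - ∫ w, g w ∂μ|} := rfl
  rw [hmean, hpre, ← Measure.map_apply hT hA, hinv]

/-- **T22 · THE EQUILIBRIUM RUNG OF S2ʳ** (`stub_detFieldConcentration_equilibrium`, v12 §12 of line
`Sketch`): for CONSTANT profiles `a, θ > 0`, `u` there is `σ₀ > 0` such that for `0 < σ < σ₀`, all
continuous `χ`, all `1`-Lipschitz `F` bounded by `1` and all `δ > 0` there is `C > 0` with, for all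
`N`, all flows `Φ` and ALL real `t`,
`G_N{δ < |F(fld(Φ_t z)) − ∫ F(fld(Φ_t w)) dG_N|} ≤ C e^{−(N+1)/C}`: the homogeneous Gibbs law
`G_N = localGibbsLaw σ a u θ N Φ` is invariant under every hard-sphere flow
(`map_flow_localGibbsLaw_const`), so the event's measure and the mean are the static ones
(`Measure.map_apply`, `integral_map`), bounded by rung R0 `stub_fieldConcentration_static` at the
constant profiles. [folklore] -/
theorem stub_detFieldConcentration_equilibrium :
    ∀ (a θ : ℝ) (u : V3), 0 < a → 0 < θ → ∃ σ₀ : ℝ, 0 < σ₀ ∧ ∀ σ : ℝ, 0 < σ → σ < σ₀ →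
      ∀ χ : T3 → ℝ, Continuous χ → ∀ F : ℝ × V3 × ℝ → ℝ, LipschitzWith 1 F → (∀ y, |F y| ≤ 1) →
        ∀ δ : ℝ, 0 < δ → ∃ C : ℝ, 0 < C ∧
          ∀ (N : ℕ) (Φ : HardSphereFlow (Torus.geometry (Fin 3)) (hsDiameter σ N) (N + 1)) (t : ℝ),
            (localGibbsLaw σ (fun _ => a) (fun _ => u) (fun _ => θ) N Φ)
                {z | δ < |F (empiricalDensityField (Φ.flow t z) χ,
                      empiricalMomentumField (Φ.flow t z) χ,
                      empiricalEnergyField (Φ.flow t z) χ) -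
                    ∫ w, F (empiricalDensityField (Φ.flow t w) χ,
                      empiricalMomentumField (Φ.flow t w) χ,
                      empiricalEnergyField (Φ.flow t w) χ)
                      ∂(localGibbsLaw σ (fun _ => a) (fun _ => u) (fun _ => θ) N Φ)|} ≤
              ENNReal.ofReal (C * Real.exp (-(C⁻¹ * ((N : ℝ) + 1)))) := by
  intro a θ u ha hθ
  obtain ⟨σ₀, hσ₀, h⟩ := stub_fieldConcentration_static (fun _ => a) (fun _ => θ) (fun _ => u)
    continuous_const continuous_const continuous_const (fun _ => ha) (fun _ => hθ)
  refine ⟨σ₀, hσ₀, fun σ hσ hσlt χ hχ F hF hF1 δ hδ => ?_⟩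
  obtain ⟨C, hC, hCN⟩ := h σ hσ hσlt χ hχ F hF hF1 δ hδ
  refine ⟨C, hC, fun N Φ t => ?_⟩
  exact (measure_setOf_lt_abs_comp_sub_integral_eq_of_map_eq (Φ.measurable_flow t)
    (map_flow_localGibbsLaw_const σ a θ u N Φ t)
    (g := fun y => F (empiricalDensityField y χ, empiricalMomentumField y χ,
      empiricalEnergyField y χ))
    (hF.continuous.measurable.comp (measurable_fieldTriple hχ)) δ).trans_le (hCN N Φ)

end Summit.AtomisticToContinuum.HydrodynamicLimit.Theorems

end
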